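import Summits.PneNP.PneNP.Theorems.ChebyshevTracialDesignGammaDirectionFirstMomentBudget
import Literature.Combinatorics.Optimization.ShellLawExcessPinning
import HarnessLib

/-!
# Cell pnp-psdrank, route `ChebyshevTracialDesign`: two discharge tools for the per-matching diagonal excess — relative level-smoothness from
# Lq-shaped budgets for ANY nonnegative level profile, and the domination of the (full, empty) law family by the plain shell law
# (brick 146b-tools; crux `TracialDecayExp20`, stmt-PneNP-19878)

Brick 146b-tools (engine seat g27; eng MEMO-26 §3). Brick 146a (`…DiagonalExcessPricing.classExcess_value_le`) prices the per-matching diagonal excess of an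
edge class CONDITIONALLY on (i) the relative level-smoothness, on a window `B`, of the (full, empty) law family
`G₂(c;x) = Σ_{v∈R}Σ_{w∈R∖v} law_{[n]∖e_v∖e_w}(t−2,c;x)` and (ii) its tail mass off `B`. This file supplies the two generic steps of the discharge:

* §1 **`relSmooth_of_budget`** — brick 137 §4's (hC) argument for an ARBITRARY level profile `g : ℕ → ℝ` with `g 0 ≥ 0`: budgets
  `c_k|Δ^k g(0)| ≤ Γ·q^k·g(0) + (4/3)^k·T` (`1 ≤ k ≤ D`, `0 ≤ q ≤ ½` — the output shape of eng g25's `levelBudget_pin2` for `G₂` at a point),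
  a floor `0 < LB ≤ g(0)` and the smallness `2Γq + D(4/3)^D·T/LB ≤ 1` give `Σ_{k=1}^{D} c_k|Δ^k g(0)| ≤ g(0)` (brick 121's criterion hypothesis);
  `sum_abs_fwdDiff_le_of_budget` is the quantitative form `≤ (2Γq + D(4/3)^D T/LB)·g(0)`.
* §2 **`sum_pairs_shellCount_le`** — the (full, empty) COUNT family is dominated by the plain count: at a matching on `[n]`, for a representative class
  `R` of constant `H`-content `σ`, `Σ_{v∈R}Σ_{w∈R∖v} Sh_{[n]∖e_v∖e_w}(t+1,c+1; x) ≤ (|R|²/4)·Sh_{[n]}(t+3,c+1; x+σ)` (Literature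
  `sum_shell_blockStat_classCount_excess_eq` with the indicator mask, dropping the nonnegative half-pinned part, and `n_R(|R|−n_R) ≤ |R|²/4`);
  **`sum_pairs_shellLaw_le`** — the LAW form `G₂(c+1;x) ≤ (|R|²/4)·(n(n−2)/((t+2−c)(n−t−c−4)))·law_{[n]}(t+3,c+1;x+σ)` (pattern probability
  `ShellLawExcessPinning.card_shellIn_full_empty_ratio`), so that the TAIL of `G₂` off a window is at most `4|R|²` times the tail of the plain shell
  law off the shifted window once `(t+2−c)(n−t−c−4) ≥ n(n−2)/16` (balanced cuts, small levels) — i.e. `ShellLawTail` on `univ` suffices.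
WHAT THIS FILE DOES NOT DO: instantiate `levelBudget_pin2` / the a-free floor (146b), the `X_k` (brick 132), the assembly (146c); anything on
`TracialDecayExp20` itself, psd rank of P_PM(K_n), or P vs NP. [cite: Rothvoss2017, §2 (PDF p. 6)] [cite: Agarwal2000DifferenceEquations, Thm. 1.8.5 (1.8.6)]
[cite: GodsilMeagher2015, §15.2]
Stature: support/instrument (kernel lane, no defs, axioms standard). Supports stmt-PneNP-19878.
-/

set_option linter.dupNamespace false -- `Summit.PneNP.PneNP.…`: summit = sub-problem (D-0017)

noncomputable section

namespace Summit.PneNP.PneNP.Theorems.ChebyshevTracialDesignDiagonalExcessBulkTools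

open Finset Literature.Barriers.PneNP Literature.Combinatorics.Optimization
open Literature.Combinatorics.Optimization.ShellStep
open Summit.PneNP.PneNP.Theorems.ChebyshevTracialDesignGammaDirectionFirstMomentBudget (sum_Ico_pow_le sum_Ico_pow_le_card_mul)

variable {n : ℕ}

/-! ### §1 Relative level-smoothness from Lq-shaped budgets, for any nonnegative profile -/

/-- **Quantitative form**: budgets `c_k|Δ^k g(0)| ≤ Γq^k g(0) + (4/3)^k T` (`1 ≤ k ≤ D`, `0 ≤ q ≤ ½`), a floor `0 < LB ≤ g(0)` ⇒
`Σ_{k=1}^{D} c_k|Δ^k g(0)| ≤ (2Γq + D(4/3)^D·T/LB)·g(0)`. [cite: Agarwal2000DifferenceEquations, Thm. 1.8.5 (1.8.6)] -/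
theorem sum_abs_fwdDiff_le_of_budget (g : ℕ → ℝ) {D : ℕ} {Γ q T LB : ℝ} (hΓ : 0 ≤ Γ) (hq : 0 ≤ q) (hq' : q ≤ 1 / 2) (hT : 0 ≤ T)
    (hg : 0 ≤ g 0)
    (hR : ∀ k ∈ Ico 1 (D + 1), (((2 * k).choose k : ℕ) : ℝ) / (4 : ℝ) ^ k * |(fwdDiff (1 : ℕ))^[k] g 0| ≤
      Γ * q ^ k * g 0 + (4 / 3 : ℝ) ^ k * T)
    (hLB0 : 0 < LB) (hLB : LB ≤ g 0) :
    ∑ k ∈ Ico 1 (D + 1), (((2 * k).choose k : ℕ) : ℝ) / (4 : ℝ) ^ k * |(fwdDiff (1 : ℕ))^[k] g 0| ≤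
      (2 * Γ * q + (D : ℝ) * (4 / 3 : ℝ) ^ D * T / LB) * g 0 := by
  have s₀ := sum_Ico_pow_le hq hq' D
  obtain ⟨s₄, -⟩ := sum_Ico_pow_le_card_mul (by norm_num : (1 : ℝ) ≤ 4 / 3) D
  have e : ∑ k ∈ Ico 1 (D + 1), (Γ * q ^ k * g 0 + (4 / 3 : ℝ) ^ k * T) =
      Γ * g 0 * ∑ k ∈ Ico 1 (D + 1), q ^ k + T * ∑ k ∈ Ico 1 (D + 1), (4 / 3 : ℝ) ^ k := by
    rw [sum_add_distrib, mul_sum, mul_sum]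
    congr 1 <;> exact sum_congr rfl fun k _ => by ring
  have m₁ : Γ * g 0 * ∑ k ∈ Ico 1 (D + 1), q ^ k ≤ Γ * g 0 * (2 * q) := mul_le_mul_of_nonneg_left s₀ (mul_nonneg hΓ hg)
  have m₂ : T * ∑ k ∈ Ico 1 (D + 1), (4 / 3 : ℝ) ^ k ≤ T * ((D : ℝ) * (4 / 3 : ℝ) ^ D) := mul_le_mul_of_nonneg_left s₄ hT
  have m₃ : T * ((D : ℝ) * (4 / 3 : ℝ) ^ D) ≤ ((D : ℝ) * (4 / 3 : ℝ) ^ D * T / LB) * g 0 := by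
    rw [div_mul_eq_mul_div, le_div_iff₀ hLB0]
    have := mul_le_mul_of_nonneg_left hLB (by positivity : 0 ≤ (D : ℝ) * (4 / 3 : ℝ) ^ D * T)
    linarith
  calc ∑ k ∈ Ico 1 (D + 1), (((2 * k).choose k : ℕ) : ℝ) / (4 : ℝ) ^ k * |(fwdDiff (1 : ℕ))^[k] g 0|
      ≤ ∑ k ∈ Ico 1 (D + 1), (Γ * q ^ k * g 0 + (4 / 3 : ℝ) ^ k * T) := sum_le_sum hR
    _ = _ := e
    _ ≤ Γ * g 0 * (2 * q) + ((D : ℝ) * (4 / 3 : ℝ) ^ D * T / LB) * g 0 := add_le_add m₁ (m₂.trans m₃)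
    _ = (2 * Γ * q + (D : ℝ) * (4 / 3 : ℝ) ^ D * T / LB) * g 0 := by ring

/-- **Relative level-smoothness from budgets** (brick 121's criterion hypothesis): under the hypotheses of `sum_abs_fwdDiff_le_of_budget` and the
smallness `2Γq + D(4/3)^D·T/LB ≤ 1`: `Σ_{k=1}^{D} c_k|Δ^k g(0)| ≤ g(0)`. [cite: Agarwal2000DifferenceEquations, Thm. 1.8.5 (1.8.6)] -/
theorem relSmooth_of_budget (g : ℕ → ℝ) {D : ℕ} {Γ q T LB : ℝ} (hΓ : 0 ≤ Γ) (hq : 0 ≤ q) (hq' : q ≤ 1 / 2) (hT : 0 ≤ T)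
    (hg : 0 ≤ g 0)
    (hR : ∀ k ∈ Ico 1 (D + 1), (((2 * k).choose k : ℕ) : ℝ) / (4 : ℝ) ^ k * |(fwdDiff (1 : ℕ))^[k] g 0| ≤
      Γ * q ^ k * g 0 + (4 / 3 : ℝ) ^ k * T)
    (hLB0 : 0 < LB) (hLB : LB ≤ g 0) (hsmall : 2 * Γ * q + (D : ℝ) * (4 / 3 : ℝ) ^ D * T / LB ≤ 1) :
    ∑ k ∈ Ico 1 (D + 1), (((2 * k).choose k : ℕ) : ℝ) / (4 : ℝ) ^ k * |(fwdDiff (1 : ℕ))^[k] g 0| ≤ g 0 :=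
  (sum_abs_fwdDiff_le_of_budget g hΓ hq hq' hT hg hR hLB0 hLB).trans
    ((mul_le_mul_of_nonneg_right hsmall hg).trans_eq (one_mul _))

/-! ### §2 The (full, empty) family is dominated by the plain shell law -/

/-- `a·(r − a) ≤ r²/4` for reals. [folklore] -/
theorem mul_sub_le_sq_div_four (a r : ℝ) : a * (r - a) ≤ r ^ 2 / 4 := by
  nlinarith [sq_nonneg (r - 2 * a)]

/-- **The (full, empty) COUNT family is dominated by the plain count.** At a matching `M` of `[n]` (partner map `π`), for a block `H`, a class `R` of
edge representatives (`v < πv`) of constant `H`-content `|e_v ∩ H| = σ`, all `t, c` and `x ∈ ℤ`: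
`Σ_{v∈R}Σ_{w∈R∖v} Sh_{[n]∖e_v∖e_w}(t+1,c+1; x) ≤ (|R|²/4)·Sh_{[n]}(t+3,c+1; x+σ)`. [cite: Rothvoss2017, §2 (PDF p. 6)] [cite: GodsilMeagher2015, §15.2] -/
theorem sum_pairs_shellCount_le (M : PMatch n) (H : Finset (Fin n)) {R : Finset (Fin n)} (hR : ∀ v ∈ R, v < M.2.partner v) {σ : ℕ}
    (hσ : ∀ v ∈ R, (({v, M.2.partner v} : Finset (Fin n)) ∩ H).card = σ) (t c : ℕ) (x : ℤ) :
    ∑ v ∈ R, ∑ w ∈ R.erase v, shellCount M.2.partner ((univ \ {v, M.2.partner v}) \ {w, M.2.partner w}) H (t + 1) (c + 1) x ≤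
      ((R.card : ℝ) ^ 2 / 4) * shellCount M.2.partner univ H (t + 3) (c + 1) (x + σ) := by
  classical
  set π := M.2.partner with hπdef
  have hπ : ∀ v, π (π v) = v := partner_partner M
  have hπ' : ∀ v, π v ≠ v := partner_ne M
  have hU : ∀ u ∈ (univ : Finset (Fin n)), π u ∈ (univ : Finset (Fin n)) := fun u _ => mem_univ _
  set ψ : ℤ → ℝ := fun z => if z = x + σ then (1 : ℝ) else 0 with hψ
  have hψ0 : ∀ z, 0 ≤ ψ z := fun z => by rw [hψ]; simp only; split_ifs <;> norm_num
  have hψ1 : ∀ z, ψ z ≤ 1 := fun z => by rw [hψ]; simp only; split_ifs <;> norm_num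
  have hsplit := sum_shell_blockStat_classCount_excess_eq hπ hπ' hU H (fun _ _ => mem_univ _) hR t c ψ
  -- LHS ≤ (|R|²/4)·Sh(x+σ)
  have hL : ∑ U ∈ shellIn π univ (t + 3) (c + 1), ψ ((U ∩ H).card : ℤ) *
      ((((R.filter fun v => v ∈ U ∧ π v ∈ U).card : ℕ) : ℝ) *
        ((R.card : ℝ) - (((R.filter fun v => v ∈ U ∧ π v ∈ U).card : ℕ) : ℝ))) ≤
      ((R.card : ℝ) ^ 2 / 4) * shellCount π univ H (t + 3) (c + 1) (x + σ) := by
    rw [shellCount_eq_sum, mul_sum]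
    refine sum_le_sum fun U _ => ?_
    have h1 := mul_sub_le_sq_div_four (((R.filter fun v => v ∈ U ∧ π v ∈ U).card : ℕ) : ℝ) (R.card : ℝ)
    have h2 : 0 ≤ (((R.filter fun v => v ∈ U ∧ π v ∈ U).card : ℕ) : ℝ) *
        ((R.card : ℝ) - (((R.filter fun v => v ∈ U ∧ π v ∈ U).card : ℕ) : ℝ)) := by
      refine mul_nonneg (Nat.cast_nonneg _) ?_
      have : (R.filter fun v => v ∈ U ∧ π v ∈ U).card ≤ R.card := card_filter_le _ _
      have : (((R.filter fun v => v ∈ U ∧ π v ∈ U).card : ℕ) : ℝ) ≤ R.card := by exact_mod_cast this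
      linarith
    rw [hψ]
    simp only
    split_ifs with hx
    · rw [one_mul, mul_one]; exact h1
    · rw [zero_mul, mul_zero]
  -- RHS ≥ the (full, empty) part = Σ shellCount''(x)
  have hE : ∀ v ∈ R, ∀ w ∈ R.erase v,
      ∑ W ∈ shellIn π ((univ \ {v, π v}) \ {w, π w}) (t + 1) (c + 1), ψ (((W ∩ H).card : ℤ) + ((({v, π v} : Finset (Fin n)) ∩ H).card : ℤ)) =
        shellCount π ((univ \ {v, π v}) \ {w, π w}) H (t + 1) (c + 1) x := by
    intro v hv w _
    rw [hσ v hv, shellCount_eq_sum]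
    refine sum_congr rfl fun W _ => ?_
    rw [hψ]
    simp only
    congr 1
    exact propext ⟨fun h => by linarith, fun h => by rw [h]⟩
  have hRge : ∑ v ∈ R, ∑ w ∈ R.erase v, shellCount π ((univ \ {v, π v}) \ {w, π w}) H (t + 1) (c + 1) x ≤
      ∑ v ∈ R, ∑ w ∈ R.erase v,
        ((∑ W ∈ shellIn π ((univ \ {v, π v}) \ {w, π w}) (t + 1) (c + 1),
            ψ (((W ∩ H).card : ℤ) + ((({v, π v} : Finset (Fin n)) ∩ H).card : ℤ))) +
          (∑ W ∈ shellIn π ((univ \ {v, π v}) \ {w, π w}) t c,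
            ψ (((W ∩ H).card : ℤ) + ((({v, π v} : Finset (Fin n)) ∩ H).card : ℤ) + (if w ∈ H then 1 else 0))) +
          (∑ W ∈ shellIn π ((univ \ {v, π v}) \ {w, π w}) t c,
            ψ (((W ∩ H).card : ℤ) + ((({v, π v} : Finset (Fin n)) ∩ H).card : ℤ) + (if π w ∈ H then 1 else 0)))) := by
    refine sum_le_sum fun v hv => sum_le_sum fun w hw => ?_
    rw [hE v hv w hw]
    have h2 := sum_nonneg fun W (_ : W ∈ shellIn π ((univ \ {v, π v}) \ {w, π w}) t c) =>
      hψ0 (((W ∩ H).card : ℤ) + ((({v, π v} : Finset (Fin n)) ∩ H).card : ℤ) + (if w ∈ H then 1 else 0))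
    have h3 := sum_nonneg fun W (_ : W ∈ shellIn π ((univ \ {v, π v}) \ {w, π w}) t c) =>
      hψ0 (((W ∩ H).card : ℤ) + ((({v, π v} : Finset (Fin n)) ∩ H).card : ℤ) + (if π w ∈ H then 1 else 0))
    linarith
  rw [← hsplit] at hRge
  exact hRge.trans hL

/-- **The (full, empty) LAW family is dominated by the plain law.** Under the hypotheses of `sum_pairs_shellCount_le`, with `c ≤ t + 1` and
`t + c + 5 ≤ n`: `Σ_{v∈R}Σ_{w∈R∖v} law_{[n]∖e_v∖e_w}(t+1,c+1; x) ≤ (|R|²/4)·(n(n−2)/((t+2−c)(n−t−c−4)))·law_{[n]}(t+3,c+1; x+σ)`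
(every doubly deleted shell has `|Shell″| = ((t+2−c)(n−t−c−4)/(n(n−2)))·|Shell_{[n]}(t+3,c+1)|`). [cite: Rothvoss2017, §2 (PDF p. 6)] [cite: GodsilMeagher2015, §15.2] -/
theorem sum_pairs_shellLaw_le (M : PMatch n) (H : Finset (Fin n)) {R : Finset (Fin n)} (hR : ∀ v ∈ R, v < M.2.partner v) {σ : ℕ}
    (hσ : ∀ v ∈ R, (({v, M.2.partner v} : Finset (Fin n)) ∩ H).card = σ) {t c : ℕ} (hct : c ≤ t + 1) (hn : t + c + 5 ≤ n) (x : ℤ) :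
    ∑ v ∈ R, ∑ w ∈ R.erase v, shellLaw M.2.partner ((univ \ {v, M.2.partner v}) \ {w, M.2.partner w}) H (t + 1) (c + 1) x ≤
      ((R.card : ℝ) ^ 2 / 4) * (((n : ℝ) * ((n : ℝ) - 2)) / (((t : ℝ) + 2 - c) * ((n : ℝ) - t - c - 4))) *
        shellLaw M.2.partner univ H (t + 3) (c + 1) (x + σ) := by
  classical
  set π := M.2.partner with hπdef
  have hπ : ∀ v, π (π v) = v := partner_partner M
  have hπ' : ∀ v, π v ≠ v := partner_ne M
  have hU : ∀ u ∈ (univ : Finset (Fin n)), π u ∈ (univ : Finset (Fin n)) := fun u _ => mem_univ _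
  have hct' : (c : ℝ) ≤ (t : ℝ) + 1 := by exact_mod_cast hct
  have hn' : (t : ℝ) + c + 5 ≤ n := by exact_mod_cast hn
  have hA : (0 : ℝ) < ((t : ℝ) + 2 - c) * ((n : ℝ) - t - c - 4) := mul_pos (by linarith) (by linarith)
  have hnn : (0 : ℝ) < (n : ℝ) * ((n : ℝ) - 2) := mul_pos (by linarith) (by linarith)
  have hcount := sum_pairs_shellCount_le M H hR hσ t c x
  -- every doubly deleted shell has the same cardinality
  have hcard : ∀ v ∈ R, ∀ w ∈ R.erase v, ((shellIn π ((univ \ {v, π v}) \ {w, π w}) (t + 1) (c + 1)).card : ℝ) =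
      (((t : ℝ) + 2 - c) * ((n : ℝ) - t - c - 4)) / ((n : ℝ) * ((n : ℝ) - 2)) * (shellIn π univ (t + 3) (c + 1)).card := by
    intro v hv w hw
    have h := card_shellIn_full_empty_ratio hπ hπ' hU (mem_univ v) (hR v hv) (mem_univ w) (hR w (mem_erase.1 hw).2) (mem_erase.1 hw).1 t c
    rw [card_univ, Fintype.card_fin] at h
    rw [div_mul_eq_mul_div, eq_div_iff hnn.ne']
    linear_combination h
  by_cases hZ : (shellIn π univ (t + 3) (c + 1)).card = 0
  · -- every shell involved is empty: both sides vanish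
    have hZ' : ∀ v ∈ R, ∀ w ∈ R.erase v, shellIn π ((univ \ {v, π v}) \ {w, π w}) (t + 1) (c + 1) = ∅ := by
      intro v hv w hw
      have h := hcard v hv w hw
      rw [hZ, Nat.cast_zero, mul_zero] at h
      exact card_eq_zero.1 (by exact_mod_cast h)
    have hl : ∑ v ∈ R, ∑ w ∈ R.erase v, shellLaw π ((univ \ {v, π v}) \ {w, π w}) H (t + 1) (c + 1) x = 0 :=
      sum_eq_zero fun v hv => sum_eq_zero fun w hw => by rw [shellLaw, hZ' v hv w hw, card_empty, Nat.cast_zero, div_zero]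
    have hr : shellLaw π univ H (t + 3) (c + 1) (x + σ) = 0 := by
      rw [shellLaw, hZ, Nat.cast_zero, div_zero]
    rw [hl, hr, mul_zero]
  · have hZpos : (0 : ℝ) < (shellIn π univ (t + 3) (c + 1)).card := by
      have : 0 < (shellIn π univ (t + 3) (c + 1)).card := Nat.pos_of_ne_zero hZ
      exact_mod_cast this
    set ρ : ℝ := (((t : ℝ) + 2 - c) * ((n : ℝ) - t - c - 4)) / ((n : ℝ) * ((n : ℝ) - 2)) with hρ
    have hρ0 : 0 < ρ := by rw [hρ]; exact div_pos hA hnn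
    -- law'' = count''/(ρ·Z); sum and compare counts
    have hl : ∑ v ∈ R, ∑ w ∈ R.erase v, shellLaw π ((univ \ {v, π v}) \ {w, π w}) H (t + 1) (c + 1) x =
        (∑ v ∈ R, ∑ w ∈ R.erase v, shellCount π ((univ \ {v, π v}) \ {w, π w}) H (t + 1) (c + 1) x) /
          (ρ * (shellIn π univ (t + 3) (c + 1)).card) := by
      rw [sum_div]
      refine sum_congr rfl fun v hv => ?_
      rw [sum_div]
      refine sum_congr rfl fun w hw => ?_
      rw [shellLaw, hcard v hv w hw]
    have hr : shellLaw π univ H (t + 3) (c + 1) (x + σ) = shellCount π univ H (t + 3) (c + 1) (x + σ) / (shellIn π univ (t + 3) (c + 1)).card := by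
      rw [shellLaw]
    rw [hl, hr, div_le_iff₀ (mul_pos hρ0 hZpos)]
    have e : ((R.card : ℝ) ^ 2 / 4) * (((n : ℝ) * ((n : ℝ) - 2)) / (((t : ℝ) + 2 - c) * ((n : ℝ) - t - c - 4))) *
        (shellCount π univ H (t + 3) (c + 1) (x + σ) / (shellIn π univ (t + 3) (c + 1)).card) *
        (ρ * (shellIn π univ (t + 3) (c + 1)).card) =
        ((R.card : ℝ) ^ 2 / 4) * shellCount π univ H (t + 3) (c + 1) (x + σ) := by
      have h1 : ((t : ℝ) + 2 - c) ≠ 0 := by linarith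
      have h2 : ((n : ℝ) - t - c - 4) ≠ 0 := by linarith
      have h3 : (n : ℝ) ≠ 0 := by linarith
      have h4 : ((n : ℝ) - 2) ≠ 0 := by linarith
      rw [hρ]
      field_simp
    rw [e]
    exact hcount

end Summit.PneNP.PneNP.Theorems.ChebyshevTracialDesignDiagonalExcessBulkTools

end
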